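import Summits.CriticalPhenomena.SAWScalingLimit.Theses.SAWSchrammPassage

/-!
# Birth skeleton — crux `SchrodingerStability` (stmt-CriticalPhenomena-19046)

Piece 1/3 (pure analysis) of the strategist's typed split of the deciding crux `ClosureToSchramm`
(stmt-CriticalPhenomena-5597, route SAWSchrammPassage; glue `ClosureToSchrammOfPieces`, stmt-17594).
The informal proof is CONTRADICTION + COMPACTNESS feeding a RIGIDITY (uniqueness) theorem; the two
registered stubs are exactly these two halves and the composition is modus ponens (a bridge seam —
honest here: the uniqueness half is a substantive theorem of analysis stated standalone, and the
compactness half is where the finite-test-data / normal-position typing of the crux is validated):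

* `stub_stripUniqueness` (provable now, L): bounded continuous WEAK solutions of `u_tt + u_θθ + u = 0` on
  the strip `ℝ × (0, π)` with `|u| ≤ 1` and uniform boundary values `−ι` at `θ → 0`, `+ι` at `θ → π`
  (`ι = ±1`) are `u = −ι cos θ`: Weyl's lemma, Fourier modes `sin(mθ)·e^(±√(m²−1)t)` unbounded for
  `m ≥ 2`, the zero mode `A sin θ` killed by `|u| ≤ 1` since `sup_θ |−ι cos θ + A sin θ| = √(1+A²)`
  [GilbargTrudinger2001 §2; Schramm2001Percolation for the profile].
* `stub_compactness` (LOAD-BEARING, L/XL): the strip uniqueness implies the finite-data statement —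
  bad sequences `δₙ → 0`; Koebe distortion + normal families for `Φₙ` (`dist(zₙ,∂Dₙ) = 1`,
  `‖Φₙ⁻¹zₙ‖ = 1`; the degeneration `arg Φₙ⁻¹zₙ → 0, π` is settled by hypothesis (i) at `zₙ` itself),
  Carathéodory kernel convergence `Dₙ → Φ_∞(ℍ)`, asymptotic equicontinuity (ii) ⇒ Arzelà–Ascoli, the
  discrete weak sums (iii) along a countable dense family of test functions converge to the weak
  equation `(Δ + π²|∇ω|²)(2H − 1) = 0`, conformal transport to the strip (`t + iθ = log Φ_∞⁻¹`), boundary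
  values from (i); then `stub_stripUniqueness` identifies the limit and contradicts badness
  [Pommerenke1992 §1.4, Lawler2005 Ch. 3].
* `SchrodingerStability_of` (PROVED): composition.
-/

noncomputable section

open MeasureTheory Set
open Summit.CriticalPhenomena.SAWScalingLimit.Theses.SAWSchrammPassage (SchrodingerStability)

set_option linter.dupNamespace false

namespace Summit.CriticalPhenomena.SAWScalingLimit.Cruxes.SchrodingerStability.Birth

/-! ## Statements -/

/-- Uniqueness of bounded weak solutions of `Δu + u = 0` on the strip `ℝ × (0, π)` with boundary values `∓ι` and
`|u| ≤ 1` (statement of `stub_stripUniqueness`). [folklore] -/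
def StripUniqueness : Prop :=
  ∀ (ι : ℝ) (u : ℝ × ℝ → ℝ), (ι = 1 ∨ ι = -1) → ContinuousOn u (Set.univ ×ˢ Set.Ioo (0 : ℝ) Real.pi : Set (ℝ × ℝ)) → (∀ z ∈ (Set.univ ×ˢ Set.Ioo (0 : ℝ) Real.pi : Set (ℝ × ℝ)), |u z| ≤ 1) → (∀ e > (0 : ℝ), ∃ θ₀ > (0 : ℝ), ∀ t θ : ℝ, 0 < θ → θ ≤ θ₀ → |u (t, θ) + ι| ≤ e ∧ |u (t, Real.pi - θ) - ι| ≤ e) → (∀ ψ : ℝ × ℝ → ℝ, ContDiff ℝ 2 ψ → HasCompactSupport ψ → tsupport ψ ⊆ (Set.univ ×ˢ Set.Ioo (0 : ℝ) Real.pi : Set (ℝ × ℝ)) → ∫ z, u z * (iteratedDeriv 2 (fun s => ψ (s, z.2)) z.1 + iteratedDeriv 2 (fun s => ψ (z.1, s)) z.2 + ψ z) = 0) → ∀ z ∈ (Set.univ ×ˢ Set.Ioo (0 : ℝ) Real.pi : Set (ℝ × ℝ)), u z = -ι * Real.cos z.2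

/-- Compactness: strip uniqueness implies Schrödinger stability in normal position with finite test data
(statement of `stub_compactness`). [conjecture] -/
def Compactness : Prop :=
  StripUniqueness → Summit.CriticalPhenomena.SAWScalingLimit.Theses.SAWSchrammPassage.SchrodingerStability

/-! ## Stubs (the only `sorry`s) -/

/-- **Stub: uniqueness of bounded weak solutions of `Δu + u = 0` on the strip `ℝ × (0, π)` with
boundary values `∓ι` and `|u| ≤ 1`.** [folklore] -/
theorem stub_stripUniqueness : StripUniqueness := by
  sorry

/-- **Stub (load-bearing): compactness — strip uniqueness implies Schrödinger stability in normal
position with finite test data.** [conjecture] -/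
theorem stub_compactness : Compactness := by
  sorry

namespace __Registered

/-- Alias of `StripUniqueness` keyed by the registered stub name. -/
abbrev stub_stripUniqueness : Prop := StripUniqueness
/-- Alias of `Compactness` keyed by the registered stub name. -/
abbrev stub_compactness : Prop := Compactness

end __Registered

/-- **Composition (kernel-checked): uniqueness + compactness ⇒ `SchrodingerStability`** (modus ponens; the
bridge seam is flagged in the card). [folklore] -/
theorem SchrodingerStability_of :
    __Registered.stub_stripUniqueness → __Registered.stub_compactness →
      Summit.CriticalPhenomena.SAWScalingLimit.Theses.SAWSchrammPassage.SchrodingerStability :=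
  fun hU hC => hC hU

/-- WIRING CHECK (an `example`: no pre-composed witness enters the environment). -/
example : Summit.CriticalPhenomena.SAWScalingLimit.Theses.SAWSchrammPassage.SchrodingerStability :=
  SchrodingerStability_of stub_stripUniqueness stub_compactness

end Summit.CriticalPhenomena.SAWScalingLimit.Cruxes.SchrodingerStability.Birth

end
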